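import Literature.Analysis.FluidPDE.SpaceTimeMomentumBalance
import Literature.MathematicalPhysics.KineticTheory.HardSphereEuler
import HarnessLib

/-!
# Crux `NearConstantShortTimeHL` (stmt-AtomisticToContinuum-12502), line `small-tilt-domination` — the mass row of the weak balance law along the flow

Lead c2, helper of `stub_gronwallAssembly`, step (2e): along a hard-sphere orbit of a good point, for a `C¹` SPACE–TIME scalar test `φ`,
`Σᵢ φ(b, xᵢ(b)) − Σᵢ φ(a, xᵢ(a)) = ∫_a^b Σᵢ Dφ(r, xᵢ(r))·(1, vᵢ(r)) dr` — the density row carries NO collisional transfer (positions are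
continuous across collisions). It is the case `ψ = 0` of the Literature's space–time momentum balance
(`IsHardSphereTrajectory.stMomentumObservable_sub_eq`, Serre's `Div M = σ^a − σ^b`), specialised to flow orbits.
-/

noncomputable section

namespace Summit.AtomisticToContinuum.HydrodynamicLimit.Theorems.NearConstantShortTimeHL

open scoped BigOperators InnerProductSpace
open MeasureTheory Set Filter
open Literature.MathematicalPhysics.KineticTheory Literature.Analysis.FluidPDE Literature.Analysis.FunctionSpaces

/-- With the zero vector test the momentum observable of the frozen field vanishes, hence so does every collision jump of it. [folklore] -/
theorem collisionJump_momentumObservable_zero {N : ℕ} (γ : ℝ → Config N (Fin 3) T3) (t : ℝ) :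
    collisionJump (momentumObservable (fun _ : T3 => (0 : V3))) γ t = 0 := by
  simp [collisionJump, momentumObservable]

/-- **The mass row of the weak balance law along the flow** (registered helper `densityRow_balance_flow`): for a hard-sphere flow `Φ` on `𝕋³`,
a good initial datum `z`, a `C¹` space–time test `φ` (`ContDiff ℝ 1 (Torus.stLift φ)`) and `a ≤ b`, the streaming integrand is interval
integrable and `Σᵢ φ(b, xᵢ(b)) − Σᵢ φ(a, xᵢ(a)) = ∫_a^b Σᵢ stFDeriv φ r xᵢ(r) (1, vᵢ(r)) dr` along the orbit `r ↦ Φ_r z`. [cite: Serre2024, §5 (16)] -/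
theorem densityRow_balance_flow : ∀ {ε : ℝ} {N : ℕ} (Φ : HardSphereFlow (Torus.geometry (Fin 3)) ε N) {z : Config N (Fin 3) T3},
    z ∈ Φ.good → ∀ {φ : ℝ → T3 → ℝ}, ContDiff ℝ 1 (Torus.stLift φ) → ∀ {a b : ℝ}, a ≤ b →
    IntervalIntegrable (fun r => ∑ i, Torus.stFDeriv φ r ((Φ.flow r z) i).1 (1, ((Φ.flow r z) i).2)) volume a b ∧
    ((∑ i, φ b ((Φ.flow b z) i).1) - ∑ i, φ a ((Φ.flow a z) i).1) =
      ∫ r in a..b, ∑ i, Torus.stFDeriv φ r ((Φ.flow r z) i).1 (1, ((Φ.flow r z) i).2) := by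
  intro ε N Φ z hz φ hφ a b hab
  have htraj := Φ.isTrajectory z hz
  have hψ : ContDiff ℝ 1 (Torus.stLift (fun (_ : ℝ) (_ : T3) => (0 : V3))) := by
    have : Torus.stLift (fun (_ : ℝ) (_ : T3) => (0 : V3)) = fun _ => 0 := by
      funext p; rfl
    rw [this]; exact contDiff_const
  obtain ⟨hint, heq⟩ := htraj.stMomentumObservable_sub_eq (ψ₀ := φ) hφ hψ hab
  have hstream : ∀ r, stMomentumStreaming φ (fun _ _ => (0 : V3)) r (Φ.flow r z) =
      ∑ i, Torus.stFDeriv φ r ((Φ.flow r z) i).1 (1, ((Φ.flow r z) i).2) := by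
    intro r
    simp only [stMomentumStreaming]
    refine Finset.sum_congr rfl fun i _ => ?_
    have h0 : Torus.stFDeriv (fun (_ : ℝ) (_ : T3) => (0 : V3)) r ((Φ.flow r z i).1) (1, (Φ.flow r z i).2) = 0 := by
      have hz0 : Torus.stLiftAt (fun (_ : ℝ) (_ : T3) => (0 : V3)) r ((Φ.flow r z i).1) =
          fun _ : ℝ × EuclideanSpace ℝ (Fin 3) => (0 : V3) := by
        funext q; rfl
      rw [Torus.stFDeriv, hz0]
      simp
    rw [h0, inner_zero_left, add_zero]
  have hobs : ∀ r, stMomentumObservable φ (fun _ _ => (0 : V3)) r (Φ.flow r z) = ∑ i, φ r ((Φ.flow r z) i).1 := by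
    intro r
    simp [stMomentumObservable]
  simp_rw [hstream] at hint heq
  refine ⟨hint, ?_⟩
  rw [hobs, hobs] at heq
  have hjumps : ∑ᶠ t ∈ collisionTimes (Torus.geometry (Fin 3)) ε (fun r => Φ.flow r z) ∩ Ioc a b,
      collisionJump (momentumObservable ((fun (_ : ℝ) (_ : T3) => (0 : V3)) t)) (fun r => Φ.flow r z) t = 0 :=
    finsum_mem_of_eqOn_zero fun t _ => collisionJump_momentumObservable_zero (fun r => Φ.flow r z) t
  rw [heq, hjumps, add_zero]

end Summit.AtomisticToContinuum.HydrodynamicLimit.Theorems.NearConstantShortTimeHL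

end
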